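import Summits.RiemannHypothesis.RiemannHypothesis.Theorems.HandoffCramerBump
import Mathlib.Analysis.Calculus.BumpFunction.Basic
import HarnessLib

/-!
# HANDOFF, edge block: FLAT-TOP profiles and lobes — definitions and elementary constants (rh-explicit, track «HANDOFF», seat prove-2 gen3, ATTEMPT-9 §2)

HONEST FRAMING. Nothing here bears on RH. `HandoffCramerBump.lean` (gen2) built the odd-sector witness from Mathlib's
normalised bump `moll 0`, whose plateau is half its support, so the resulting necessary Cramér constant
`cramerGapConst` is neither numerical nor sharp. This file sets up the FLAT bumps `flatBump k` (a `ContDiffBump` at `0`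
with inner radius `1 − 1/(k+2)` and outer radius `1`): mass `M_k = ∫ψ_k` and energy `N_k = ∫ψ_k²` both lie in
`[2 − 2/(k+2), 2]`, so the mass ratio `M_k²/(2N_k) → 1` — what the sharp (⇒) direction of the edge-block classification
needs (ATTEMPT-7 §3: `g*/(√q log q) → 1/m²`). The energy ceiling of the scaled lobes is in `HandoffFlatLobe.lean`.

* `flatBump`, `flatProfile`, `flatMass`, `flatLogMoment`, `flatEnergyConst`, `flatLobe` — DEFINITIONS (explicit bodies).
* `two_mul_rIn_le_flatMass`, `flatMass_le_two`, `two_mul_rIn_le_weilNorm2Sq_flatProfile`, `weilNorm2Sq_flatProfile_le_two`;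
  `norm_weilMellin_flatProfile_le` (`‖ψ̂(s)‖ ≤ 2e^{|Re s − ½|}`), `re_weilMellin_flatProfile_real_ge` (`Re ψ̂(σ) ≥ e^{−|σ−½|}·M_k`);
  `flatLobe k r x₀ = ψ_k((· − x₀)/r)`: test function, support `[x₀ − r, x₀ + r]`, `∫‖·‖² = r·N_k`, Mellin transform
  `e^{(s−½)x₀}·r·ψ̂_k(½ + r(s − ½))` (all PROVED; the pattern is `HandoffCramerBump.lean` §2–§3 with `moll 0 → ψ_k`).
-/

set_option linter.dupNamespace false

noncomputable section

open Complex Filter Set MeasureTheory Metric Literature.NumberTheory.LFunctions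
  Literature.NumberTheory.LFunctions.WeilContinuous
open scoped Real Topology ComplexConjugate ContDiff

namespace Summit.RiemannHypothesis.RiemannHypothesis.Theorems.Handoff

/-! ## §1 The flat bumps and their profile constants -/

/-- The flat bump of order `k`: a smooth bump at `0`, equal to `1` on `[−(1 − 1/(k+2)), 1 − 1/(k+2)]`, supported in
`(−1, 1)`, with values in `[0, 1]`. [this track, ATTEMPT-9 §2] -/
def flatBump (k : ℕ) : ContDiffBump (0 : ℝ) where
  rIn := 1 - 1 / ((k : ℝ) + 2)
  rOut := 1
  rIn_pos := by
    have hk : (2 : ℝ) ≤ (k : ℝ) + 2 := by linarith [(Nat.cast_nonneg k : (0 : ℝ) ≤ k)]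
    have : 1 / ((k : ℝ) + 2) ≤ 1 / 2 := div_le_div_of_nonneg_left (by norm_num) (by norm_num) hk
    linarith
  rIn_lt_rOut := by
    have : 0 < 1 / ((k : ℝ) + 2) := by positivity
    linarith

/-- `rOut = 1`. [folklore] -/
theorem flatBump_rOut (k : ℕ) : (flatBump k).rOut = 1 := rfl

/-- `rIn = 1 − 1/(k+2)`. [folklore] -/
theorem flatBump_rIn (k : ℕ) : (flatBump k).rIn = 1 - 1 / ((k : ℝ) + 2) := rfl

/-- `1/2 ≤ rIn`. [folklore] -/
theorem half_le_flatBump_rIn (k : ℕ) : 1 / 2 ≤ (flatBump k).rIn := by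
  rw [flatBump_rIn]
  have hk : (2 : ℝ) ≤ (k : ℝ) + 2 := by linarith [(Nat.cast_nonneg k : (0 : ℝ) ≤ k)]
  have : 1 / ((k : ℝ) + 2) ≤ 1 / 2 := div_le_div_of_nonneg_left (by norm_num) (by norm_num) hk
  linarith

/-- `rIn < 1`. [folklore] -/
theorem flatBump_rIn_lt_one (k : ℕ) : (flatBump k).rIn < 1 := (flatBump k).rIn_lt_rOut

/-- The flat profile as a complex function. [this track, ATTEMPT-9 §2] -/
def flatProfile (k : ℕ) : ℝ → ℂ := fun x ↦ (((flatBump k) x : ℝ) : ℂ)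

/-- `ψ_k(x) = 0` for `|x| ≥ 1`. [folklore] -/
theorem flatProfile_eq_zero {k : ℕ} {x : ℝ} (hx : 1 ≤ |x|) : flatProfile k x = 0 := by
  have h : (flatBump k) x = 0 := (flatBump k).zero_of_le_dist (by simpa [flatBump_rOut, Real.dist_eq] using hx)
  simp [flatProfile, h]

/-- `ψ_k(x) = 1` for `|x| ≤ rIn`. [folklore] -/
theorem flatProfile_eq_one {k : ℕ} {x : ℝ} (hx : |x| ≤ (flatBump k).rIn) : flatProfile k x = 1 := by
  have h : (flatBump k) x = 1 :=
    (flatBump k).one_of_mem_closedBall (by simpa [mem_closedBall, Real.dist_eq] using hx)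
  simp [flatProfile, h]

/-- `‖ψ_k(x)‖ = ψ_k(x)` (a nonnegative real). [folklore] -/
theorem norm_flatProfile (k : ℕ) (x : ℝ) : ‖flatProfile k x‖ = (flatBump k) x := by
  rw [flatProfile, Complex.norm_real, Real.norm_eq_abs, abs_of_nonneg ((flatBump k).nonneg)]

/-- `‖ψ_k(x)‖ ≤ 1`. [folklore] -/
theorem norm_flatProfile_le_one (k : ℕ) (x : ℝ) : ‖flatProfile k x‖ ≤ 1 := by
  rw [norm_flatProfile]; exact (flatBump k).le_one

/-- `ψ_k` is continuous. [folklore] -/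
theorem continuous_flatProfile (k : ℕ) : Continuous (flatProfile k) :=
  Complex.continuous_ofReal.comp (flatBump k).continuous

/-- `ψ_k` has compact support. [folklore] -/
theorem hasCompactSupport_flatProfile (k : ℕ) : HasCompactSupport (flatProfile k) :=
  (flatBump k).hasCompactSupport.comp_left (g := fun r : ℝ ↦ (r : ℂ)) Complex.ofReal_zero

/-- `ψ_k` is a Weil test function. [folklore] -/
theorem isWeilTest_flatProfile (k : ℕ) : IsWeilTest (flatProfile k) :=
  ⟨Complex.ofRealCLM.contDiff.comp (flatBump k).contDiff, hasCompactSupport_flatProfile k⟩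

/-- `tsupport ψ_k ⊆ [−1, 1]`. [folklore] -/
theorem tsupport_flatProfile_subset (k : ℕ) : tsupport (flatProfile k) ⊆ Icc (-1 : ℝ) 1 := by
  refine closure_minimal (fun x hx ↦ ?_) isClosed_Icc
  rw [Function.mem_support] at hx
  by_contra hx'
  apply hx
  apply flatProfile_eq_zero
  rw [Set.mem_Icc, not_and_or, not_le, not_le] at hx'
  rcases hx' with h | h
  · rw [abs_of_neg (by linarith)]; linarith
  · rw [abs_of_pos (by linarith)]; linarith

/-- `‖ψ_k‖` is integrable. [folklore] -/
theorem integrable_norm_flatProfile (k : ℕ) : Integrable fun x ↦ ‖flatProfile k x‖ :=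
  ((continuous_flatProfile k).integrable_of_hasCompactSupport (hasCompactSupport_flatProfile k)).norm


/-- `‖ψ_k‖²` is integrable. [folklore] -/
theorem integrable_norm_sq_flatProfile (k : ℕ) : Integrable fun x ↦ ‖flatProfile k x‖ ^ 2 := by
  refine ((continuous_flatProfile k).norm.pow 2).integrable_of_hasCompactSupport ?_
  refine HasCompactSupport.intro (isCompact_Icc (a := (-1 : ℝ)) (b := 1)) fun x hx ↦ ?_
  have : flatProfile k x = 0 := by
    apply flatProfile_eq_zero
    rw [Set.mem_Icc, not_and_or, not_le, not_le] at hx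
    rcases hx with h | h
    · rw [abs_of_neg (by linarith)]; linarith
    · rw [abs_of_pos (by linarith)]; linarith
  simp [this]

/-- The mass `M_k = ∫ ψ_k`. [this track, ATTEMPT-9 §2] -/
def flatMass (k : ℕ) : ℝ := ∫ x : ℝ, (flatBump k) x

/-- `∫ ‖ψ_k‖ = M_k`. [folklore] -/
theorem integral_norm_flatProfile (k : ℕ) : ∫ x : ℝ, ‖flatProfile k x‖ = flatMass k := by
  simp_rw [norm_flatProfile]; rfl

/-- `M_k ≤ 2` (`ψ_k ≤ 1` on `[−1, 1]`, `0` outside). [folklore] -/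
theorem flatMass_le_two (k : ℕ) : flatMass k ≤ 2 := by
  have h : ∫ x : ℝ, (flatBump k) x ≤ ∫ x in Icc (-1 : ℝ) 1, (1 : ℝ) := by
    rw [← integral_indicator measurableSet_Icc]
    refine integral_mono (flatBump k).integrable ((integrable_indicator_iff measurableSet_Icc).2
      (integrableOn_const (by rw [Real.volume_Icc]; exact ENNReal.ofReal_ne_top))) fun x ↦ ?_
    by_cases hx : x ∈ Icc (-1 : ℝ) 1
    · rw [indicator_of_mem hx]; exact (flatBump k).le_one
    · rw [indicator_of_notMem hx]
      have : (flatBump k) x = 0 := by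
        apply (flatBump k).zero_of_le_dist
        rw [Set.mem_Icc, not_and_or, not_le, not_le] at hx
        rw [flatBump_rOut, Real.dist_eq, sub_zero]
        rcases hx with h | h
        · rw [abs_of_neg (by linarith)]; linarith
        · rw [abs_of_pos (by linarith)]; linarith
      rw [this]
  have h2 : ∫ x in Icc (-1 : ℝ) 1, (1 : ℝ) = 2 := by
    rw [setIntegral_const, smul_eq_mul, mul_one, Real.volume_real_Icc_of_le (by norm_num)]; norm_num
  unfold flatMass
  linarith

/-- `2·rIn ≤ M_k` (`ψ_k = 1` on `[−rIn, rIn]`, `ψ_k ≥ 0`). [folklore] -/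
theorem two_mul_rIn_le_flatMass (k : ℕ) : 2 * (flatBump k).rIn ≤ flatMass k := by
  set ρ := (flatBump k).rIn with hρ
  have hρ0 : 0 < ρ := (flatBump k).rIn_pos
  have h : ∫ x in Icc (-ρ) ρ, (1 : ℝ) ≤ ∫ x : ℝ, (flatBump k) x := by
    rw [← integral_indicator measurableSet_Icc]
    refine integral_mono ((integrable_indicator_iff measurableSet_Icc).2
      (integrableOn_const (by rw [Real.volume_Icc]; exact ENNReal.ofReal_ne_top))) (flatBump k).integrable fun x ↦ ?_
    by_cases hx : x ∈ Icc (-ρ) ρ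
    · rw [indicator_of_mem hx]
      have : (flatBump k) x = 1 := (flatBump k).one_of_mem_closedBall (by
        rw [mem_closedBall, Real.dist_eq, sub_zero]; exact abs_le.2 ⟨hx.1, hx.2⟩)
      rw [this]
    · rw [indicator_of_notMem hx]; exact (flatBump k).nonneg
  have h2 : ∫ x in Icc (-ρ) ρ, (1 : ℝ) = 2 * ρ := by
    rw [setIntegral_const, smul_eq_mul, mul_one, Real.volume_real_Icc_of_le (by linarith)]; ring
  unfold flatMass
  linarith

/-- `1 ≤ M_k`. [folklore] -/
theorem one_le_flatMass (k : ℕ) : 1 ≤ flatMass k := by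
  have := two_mul_rIn_le_flatMass k
  have := half_le_flatBump_rIn k
  linarith

/-- `N_k = ∫‖ψ_k‖² ≤ 2`. [folklore] -/
theorem weilNorm2Sq_flatProfile_le_two (k : ℕ) : weilNorm2Sq (flatProfile k) ≤ 2 := by
  unfold weilNorm2Sq
  have h : ∫ x : ℝ, ‖flatProfile k x‖ ^ 2 ≤ ∫ x : ℝ, ‖flatProfile k x‖ := by
    refine integral_mono (integrable_norm_sq_flatProfile k) (integrable_norm_flatProfile k) fun x ↦ ?_
    have h1 := norm_flatProfile_le_one k x
    have h0 := norm_nonneg (flatProfile k x)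
    nlinarith
  rw [integral_norm_flatProfile] at h
  linarith [flatMass_le_two k]

/-- `2·rIn ≤ N_k` (`‖ψ_k‖² = 1` on `[−rIn, rIn]`). [folklore] -/
theorem two_mul_rIn_le_weilNorm2Sq_flatProfile (k : ℕ) : 2 * (flatBump k).rIn ≤ weilNorm2Sq (flatProfile k) := by
  set ρ := (flatBump k).rIn with hρ
  have hρ0 : 0 < ρ := (flatBump k).rIn_pos
  have hint : Integrable fun x : ℝ ↦ ‖flatProfile k x‖ ^ 2 := integrable_norm_sq_flatProfile k
  have h : ∫ x in Icc (-ρ) ρ, (1 : ℝ) ≤ ∫ x : ℝ, ‖flatProfile k x‖ ^ 2 := by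
    rw [← integral_indicator measurableSet_Icc]
    refine integral_mono ((integrable_indicator_iff measurableSet_Icc).2
      (integrableOn_const (by rw [Real.volume_Icc]; exact ENNReal.ofReal_ne_top))) hint fun x ↦ ?_
    by_cases hx : x ∈ Icc (-ρ) ρ
    · rw [indicator_of_mem hx]
      have : flatProfile k x = 1 := flatProfile_eq_one (abs_le.2 ⟨hx.1, hx.2⟩)
      simp [this]
    · rw [indicator_of_notMem hx]; positivity
  have h2 : ∫ x in Icc (-ρ) ρ, (1 : ℝ) = 2 * ρ := by
    rw [setIntegral_const, smul_eq_mul, mul_one, Real.volume_real_Icc_of_le (by linarith)]; ring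
  unfold weilNorm2Sq
  linarith

/-- `1 ≤ N_k`. [folklore] -/
theorem one_le_weilNorm2Sq_flatProfile (k : ℕ) : 1 ≤ weilNorm2Sq (flatProfile k) := by
  have := two_mul_rIn_le_weilNorm2Sq_flatProfile k
  have := half_le_flatBump_rIn k
  linarith

/-! ## §2 The transform of the profile -/

/-- `‖ψ̂_k(s)‖ ≤ 2·e^{|Re s − ½|}`. [folklore] -/
theorem norm_weilMellin_flatProfile_le (k : ℕ) (s : ℂ) :
    ‖weilMellin (flatProfile k) s‖ ≤ 2 * Real.exp |s.re - 1 / 2| := by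
  unfold weilMellin
  calc ‖∫ t : ℝ, flatProfile k t * cexp ((s - 1 / 2) * t)‖ ≤ ∫ t : ℝ, ‖flatProfile k t * cexp ((s - 1 / 2) * t)‖ :=
        norm_integral_le_integral_norm _
    _ ≤ ∫ t : ℝ, ‖flatProfile k t‖ * Real.exp |s.re - 1 / 2| := by
        refine integral_mono_of_nonneg (Eventually.of_forall fun _ ↦ norm_nonneg _)
          ((integrable_norm_flatProfile k).mul_const _) (Eventually.of_forall fun t ↦ ?_)
        simp only [norm_mul, Complex.norm_exp]
        rcases le_or_gt 1 |t| with ht | ht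
        · rw [flatProfile_eq_zero ht]; simp
        · refine mul_le_mul_of_nonneg_left (Real.exp_le_exp.2 ?_) (norm_nonneg _)
          have hre : ((s - 1 / 2) * (t : ℂ)).re = (s.re - 1 / 2) * t := by simp [sub_re, mul_re]
          rw [hre]
          calc (s.re - 1 / 2) * t ≤ |(s.re - 1 / 2) * t| := le_abs_self _
            _ = |s.re - 1 / 2| * |t| := abs_mul _ _
            _ ≤ |s.re - 1 / 2| * 1 := by gcongr
            _ = |s.re - 1 / 2| := mul_one _
    _ = flatMass k * Real.exp |s.re - 1 / 2| := by rw [MeasureTheory.integral_mul_const, integral_norm_flatProfile]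
    _ ≤ 2 * Real.exp |s.re - 1 / 2| := mul_le_mul_of_nonneg_right (flatMass_le_two k) (Real.exp_pos _).le

/-- `Re ψ̂_k(σ) ≥ e^{−|σ−½|}·M_k` for real `σ` (`ψ_k ≥ 0` on `[−1, 1]`). [folklore] -/
theorem re_weilMellin_flatProfile_real_ge (k : ℕ) (σ : ℝ) :
    Real.exp (-|σ - 1 / 2|) * flatMass k ≤ (weilMellin (flatProfile k) (σ : ℂ)).re := by
  set φ : ℝ → ℝ := fun t ↦ (flatBump k) t with hφ
  have e : (fun t : ℝ ↦ flatProfile k t * cexp (((σ : ℂ) - 1 / 2) * (t : ℂ))) =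
      fun t : ℝ ↦ ((φ t * Real.exp ((σ - 1 / 2) * t) : ℝ) : ℂ) := by
    funext t
    rw [show ((σ : ℂ) - 1 / 2) * (t : ℂ) = (((σ - 1 / 2) * t : ℝ) : ℂ) by push_cast; ring, ← Complex.ofReal_exp]
    simp only [flatProfile, hφ]
    push_cast
    ring
  have hM : weilMellin (flatProfile k) σ = ((∫ t : ℝ, φ t * Real.exp ((σ - 1 / 2) * t) : ℝ) : ℂ) := by
    unfold weilMellin
    rw [e, integral_complex_ofReal]
  rw [hM, Complex.ofReal_re]
  have hφc : Continuous φ := (flatBump k).continuous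
  have hφs : HasCompactSupport φ := (flatBump k).hasCompactSupport
  have hint1 : Integrable fun t : ℝ ↦ φ t * Real.exp ((σ - 1 / 2) * t) :=
    (hφc.mul (by fun_prop)).integrable_of_hasCompactSupport hφs.mul_right
  have hint0 : Integrable fun t : ℝ ↦ φ t * Real.exp (-|σ - 1 / 2|) := (flatBump k).integrable.mul_const _
  have hone : ∫ t : ℝ, φ t * Real.exp (-|σ - 1 / 2|) = Real.exp (-|σ - 1 / 2|) * flatMass k := by
    rw [integral_mul_const]; unfold flatMass; ring
  rw [← hone]
  refine integral_mono hint0 hint1 fun t ↦ ?_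
  have hφ0 : 0 ≤ φ t := (flatBump k).nonneg
  by_cases ht : 1 ≤ |t|
  · have hz : φ t = 0 := by
      have h := flatProfile_eq_zero (k := k) ht
      simp only [flatProfile, Complex.ofReal_eq_zero] at h
      exact h
    simp only [hz, zero_mul, le_refl]
  · refine mul_le_mul_of_nonneg_left (Real.exp_le_exp.2 ?_) hφ0
    rw [not_le] at ht
    have h1 : |(σ - 1 / 2) * t| ≤ |σ - 1 / 2| * 1 := by
      rw [abs_mul]; exact mul_le_mul_of_nonneg_left ht.le (abs_nonneg _)
    linarith [neg_abs_le ((σ - 1 / 2) * t)]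

/-- The log-moment `L_k = ∫‖ψ̂_k(½+iu)‖² log(1+|u|) du` (finite, unevaluated). [this track, ATTEMPT-9 §2] -/
def flatLogMoment (k : ℕ) : ℝ :=
  ∫ u : ℝ, ‖weilMellin (flatProfile k) (1 / 2 + u * I)‖ ^ 2 * Real.log (1 + |u|)

/-- `L_k ≥ 0`. [folklore] -/
theorem flatLogMoment_nonneg (k : ℕ) : 0 ≤ flatLogMoment k :=
  integral_nonneg fun u ↦ mul_nonneg (sq_nonneg _) (Real.log_nonneg (by linarith [abs_nonneg u]))

/-- The additive constant of the flat energy ceiling: `6.125 + L_k/(2π)`. [this track, ATTEMPT-9 §2] -/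
def flatEnergyConst (k : ℕ) : ℝ :=
  6.125 + flatLogMoment k / (2 * π)

/-- `flatEnergyConst k ≥ 6`. [folklore] -/
theorem six_le_flatEnergyConst (k : ℕ) : 6 ≤ flatEnergyConst k := by
  unfold flatEnergyConst
  have := div_nonneg (flatLogMoment_nonneg k) (by positivity : (0:ℝ) ≤ 2 * π)
  linarith

/-! ## §3 The flat lobe `ψ_k((· − x₀)/r)` -/

/-- The flat lobe: `ψ_k` squeezed to radius `r` and centred at `x₀`. [this track, ATTEMPT-9 §2] -/
def flatLobe (k : ℕ) (r x₀ : ℝ) : ℝ → ℂ :=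
  fun x ↦ flatProfile k ((x - x₀) / r)

variable {k : ℕ} {r : ℝ}

/-- Off `[x₀ − r, x₀ + r]` the lobe vanishes (`r > 0`). [folklore] -/
theorem flatLobe_eq_zero {x₀ x : ℝ} (hr : 0 < r) (hx : x ∉ Icc (x₀ - r) (x₀ + r)) : flatLobe k r x₀ x = 0 := by
  unfold flatLobe
  apply flatProfile_eq_zero
  rw [Set.mem_Icc, not_and_or, not_le, not_le] at hx
  rcases hx with h | h
  · have : (x - x₀) / r < -1 := by rw [div_lt_iff₀ hr]; linarith
    rw [abs_of_neg (by linarith)]; linarith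
  · have : 1 < (x - x₀) / r := by rw [lt_div_iff₀ hr]; linarith
    rw [abs_of_pos (by linarith)]; linarith

/-- The flat lobe is a Weil test function (`r > 0`). [folklore] -/
theorem isWeilTest_flatLobe (hr : 0 < r) (x₀ : ℝ) : IsWeilTest (flatLobe k r x₀) := by
  refine ⟨(isWeilTest_flatProfile k).1.comp ((contDiff_id.sub contDiff_const).div_const r), ?_⟩
  exact HasCompactSupport.intro isCompact_Icc (fun x hx ↦ flatLobe_eq_zero hr hx)

/-- Support of the flat lobe. [folklore] -/
theorem tsupport_flatLobe_subset (hr : 0 < r) (x₀ : ℝ) : tsupport (flatLobe k r x₀) ⊆ Icc (x₀ - r) (x₀ + r) :=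
  closure_minimal (fun x hx ↦ by
    by_contra h
    exact (Function.mem_support.1 hx) (flatLobe_eq_zero hr h)) isClosed_Icc

/-- `∫‖flatLobe k r x₀‖² = r·N_k` (`r > 0`). [folklore] -/
theorem integral_norm_sq_flatLobe (hr : 0 < r) (x₀ : ℝ) :
    ∫ x : ℝ, ‖flatLobe k r x₀ x‖ ^ 2 = r * weilNorm2Sq (flatProfile k) := by
  unfold flatLobe weilNorm2Sq
  have h1 : ∫ x : ℝ, ‖flatProfile k ((x - x₀) / r)‖ ^ 2 = ∫ x : ℝ, ‖flatProfile k (x / r)‖ ^ 2 :=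
    integral_sub_right_eq_self (fun x : ℝ ↦ ‖flatProfile k (x / r)‖ ^ 2) x₀
  rw [h1, Measure.integral_comp_div (fun y : ℝ ↦ ‖flatProfile k y‖ ^ 2) r, abs_of_pos hr, smul_eq_mul]

/-- The lobe as a translate of a dilate. [folklore] -/
theorem flatLobe_eq_weilTranslate (k : ℕ) (r x₀ : ℝ) :
    flatLobe k r x₀ = weilTranslate (fun t ↦ flatProfile k (r⁻¹ * t)) x₀ := by
  funext x
  simp [flatLobe, weilTranslate, div_eq_inv_mul]

/-- **Mellin transform of the flat lobe**: `f̂(s) = e^{(s−½)x₀}·r·ψ̂_k(½ + r(s − ½))` (`r > 0`). [folklore] -/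
theorem weilMellin_flatLobe (hr : 0 < r) (x₀ : ℝ) (s : ℂ) :
    weilMellin (flatLobe k r x₀) s =
      cexp ((s - 1 / 2) * x₀) * ((r : ℂ) * weilMellin (flatProfile k) (1 / 2 + (r : ℂ) * (s - 1 / 2))) := by
  rw [flatLobe_eq_weilTranslate, weilMellin_weilTranslate, weilMellin_comp_mul (flatProfile k) (inv_pos.2 hr)]
  congr 2
  · push_cast
    rw [inv_inv]
  · congr 1
    push_cast
    have : ((r : ℂ))⁻¹ ≠ 0 := inv_ne_zero (Complex.ofReal_ne_zero.2 hr.ne')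
    field_simp

/-- On the critical line: `‖f̂(½ + it)‖² = r²·‖ψ̂_k(½ + i·rt)‖²`. [folklore] -/
theorem norm_sq_weilMellin_flatLobe_half (hr : 0 < r) (x₀ t : ℝ) :
    ‖weilMellin (flatLobe k r x₀) (1 / 2 + t * I)‖ ^ 2 =
      r ^ 2 * ‖weilMellin (flatProfile k) (1 / 2 + (r * t : ℝ) * I)‖ ^ 2 := by
  rw [weilMellin_flatLobe hr]
  have e1 : (1 / 2 + (t : ℂ) * I - 1 / 2) * (x₀ : ℂ) = ((t * x₀ : ℝ) : ℂ) * I := by push_cast; ring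
  have e2 : (1 : ℂ) / 2 + (r : ℂ) * (1 / 2 + (t : ℂ) * I - 1 / 2) = 1 / 2 + ((r * t : ℝ) : ℂ) * I := by push_cast; ring
  rw [e1, e2, norm_mul, norm_mul, Complex.norm_exp_ofReal_mul_I, Complex.norm_real, Real.norm_eq_abs, abs_of_pos hr]
  ring

/-- `‖f̂(σ)‖ ≤ 2e^{r/2}·r… precisely `‖f̂(s)‖ ≤ e^{(Re s − ½)x₀}·r·2e^{r|Re s − ½|}`; used at `s = 0, 1` with `x₀`
absorbed by translation invariance, so we only record the centred case `x₀ = 0`: `‖f̂(s)‖ ≤ 2r·e^{r|Re s − ½|}`. [folklore] -/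
theorem norm_weilMellin_flatLobe_zero_le (hr : 0 < r) (s : ℂ) :
    ‖weilMellin (flatLobe k r 0) s‖ ≤ 2 * r * Real.exp (r * |s.re - 1 / 2|) := by
  rw [weilMellin_flatLobe hr, norm_mul, norm_mul, Complex.norm_real, Real.norm_eq_abs, abs_of_pos hr]
  have h0 : ‖cexp ((s - 1 / 2) * ((0 : ℝ) : ℂ))‖ = 1 := by simp
  rw [h0, one_mul]
  have h := norm_weilMellin_flatProfile_le k (1 / 2 + (r : ℂ) * (s - 1 / 2))
  have hre : ((1 : ℂ) / 2 + (r : ℂ) * (s - 1 / 2)).re - 1 / 2 = r * (s.re - 1 / 2) := by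
    simp [Complex.mul_re]
  rw [hre, abs_mul, abs_of_pos hr] at h
  calc r * ‖weilMellin (flatProfile k) (1 / 2 + (r : ℂ) * (s - 1 / 2))‖ ≤ r * (2 * Real.exp (r * |s.re - 1 / 2|)) :=
        mul_le_mul_of_nonneg_left h hr.le
    _ = 2 * r * Real.exp (r * |s.re - 1 / 2|) := by ring

end Summit.RiemannHypothesis.RiemannHypothesis.Theorems.Handoff
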